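import Summits.Ventures.AbcSig.Rows.TemplateC2a
import Summits.Ventures.AbcSig.Levels.N101
import Summits.Ventures.AbcSig.Levels.N202

/-!
# Venture AbcSig — ROW `C2aL101A6`: `xⁿ + 2^a·101^m·yⁿ = z²`, class `a ge6` (GENERATED by plean/leanrow.py)

HONEST FRAMING. A row of a COMPUTATION cell (`pub-abcsig`); a CONDITIONAL theorem, no claim on ABC or any summit.
Hypotheses: `BS04Package` (CITED), `DataComplete` at levels [101, 202] (COMPUTED, two-engine certified
level files), and the listed per-orbit exclusions `hX_…` (CITED — e.g. the cell's M6 Eisenstein certificates; the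
row's R5 cell names each). Everything else is kernel-checked (`Rows/TemplateC2a.lean`, `Levels/N….lean`). Exponent
range: prime `n ≥ 11`, `n ≠ 101`; `B = 2^a 101^m` with `a, m < n` (n-th-power free).

-/

namespace Summit.Ventures.AbcSig

/-- Row `C2aL101A6` (see module docstring). -/
theorem row_C2aL101A6 (M : NewformModel) (hP : M.BS04Package)
    (hD101 : M.DataComplete 101 level101Orbits) (hD202 : M.DataComplete 202 level202Orbits)
    (n : ℕ) (hn : n.Prime) (hmin : 11 ≤ n) (hnℓ : n ≠ 101) (a m : ℕ) (ha : 6 ≤ a) (hm : 1 ≤ m) (han : a < n) (hmn : m < n)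
    (hX_orbit_202_3 : n ∈ ([17] : List ℕ) → M.Excludes 202 orbit_202_3 (famB (2 ^ a * 101 ^ m) n (fun _ _ => True)))
    (x y z : ℤ) (hxy1 : x * y ≠ 1) (hxy2 : x * y ≠ -1) : ¬ IsPrimitiveSolution 1 (2 ^ a * 101 ^ m) 1 n x y z := by
  have hℓ : Nat.Prime 101 := by norm_num
  have h7 : 7 ≤ n := by omega
  have hS101 :=
    (level101_sieve n hn h7 (fun o => M.Excludes 101 o (famB (2 ^ a * 101 ^ m) n (fun _ _ => True))) (fun h => absurd h (by simp only [List.mem_cons, List.not_mem_nil, or_false]; omega)) (fun h => absurd h (by simp only [List.mem_cons, List.not_mem_nil, or_false]; omega)))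
  have hS202 :=
    (level202_sieve n hn h7 (fun o => M.Excludes 202 o (famB (2 ^ a * 101 ^ m) n (fun _ _ => True))) (fun h => absurd h (by simp only [List.mem_cons, List.not_mem_nil, or_false]; omega)) hX_orbit_202_3)
  by_cases ha6 : a = 6
  · subst ha6
    exact rowC2a_a6 101 hℓ (by norm_num) M hP n hn h7 hnℓ hD101 hD202 m hm hmn
      hS101
      hS202 x y z hxy1 hxy2
  · exact rowC2a_age7 101 hℓ (by norm_num) M hP n hn h7 hnℓ hD202 a m (by omega) hm han hmn
      hS202 x y z hxy1 hxy2

end Summit.Ventures.AbcSig
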